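import Summits.NavierStokesRegularity.NavierStokesRegularity.Theses.FilamentSkeletonRss
import Literature.Analysis.FluidPDE.GaussianVortexPlanarProofs
import Literature.Analysis.FluidPDE.WholeSpaceIBP
import Literature.Analysis.FluidPDE.GaussianVortexFormDomainPoincare
import Summits.AnomalousDissipation.AnomalousDissipation.Theorems.MarginalStabilityChainStretchedVortexRowsStubCoreInverseIntegrabilityTools

/-!
# Integration-by-parts tools for stub `stub_gradientInClass` of crux `CoreLinearInvertibility`
# (stmt-NavierStokesRegularity-17973), line `Sketch`

(log: v1 — `v^G` bounded, cut-off gradient/moment bounds, coordinate integrations by parts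
against a compactly supported weight, the Laplacian pairing, Fatou along truncations, scalar
AM–GM lemmas; `continuous_gaussVortexVelocity` / `continuous_strainedVorticityOperator` are reused
from the AnomalousDissipation core-inverse tools file, as the sibling stub files of this crux do.)
-/

set_option linter.dupNamespace false

noncomputable section

namespace Summit.NavierStokesRegularity.NavierStokesRegularity.Theorems

open MeasureTheory Filter Topology Set Metric
open Literature.Analysis.FluidPDE
open scoped InnerProductSpace Laplacian ContDiff ENNReal
open Summit.AnomalousDissipation.AnomalousDissipation.Theorems.MarginalStabilityChainStretchedVortexRows
  (continuous_gaussVortexVelocity)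

/-! ### The Gaussian vortex velocity is bounded -/

/-- `‖v^G(ξ)‖ ≤ (4π)⁻¹`: `‖v^G(ξ)‖ = (8π)⁻¹ φ(|ξ|²/4)|ξ|` with `φ ≤ 1` (so `≤ 2(8π)⁻¹` for
`|ξ| ≤ 2`) and `tφ(t) = 1 − e^{−t} ≤ 1` (so `φ(t)|ξ| ≤ 2tφ(t) ≤ 2` for `|ξ| ≥ 2`). [folklore] -/
theorem norm_gaussVortexVelocity_le_inv_four_pi (x : EuclideanSpace ℝ (Fin 2)) :
    ‖gaussVortexVelocity x‖ ≤ (4 * Real.pi)⁻¹ := by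
  have hφ := burgersPhi_pos (‖x‖ ^ 2 / 4)
  have hpi : 0 < Real.pi := Real.pi_pos
  have hn : ‖gaussVortexVelocity x‖ = (8 * Real.pi)⁻¹ * (burgersPhi (‖x‖ ^ 2 / 4) * ‖x‖) := by
    rw [gaussVortexVelocity, norm_smul, norm_perp, Real.norm_of_nonneg (by positivity)]
    ring
  have key : burgersPhi (‖x‖ ^ 2 / 4) * ‖x‖ ≤ 2 := by
    by_cases hx : ‖x‖ ≤ 2
    · calc burgersPhi (‖x‖ ^ 2 / 4) * ‖x‖ ≤ 1 * ‖x‖ := by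
            gcongr; exact burgersPhi_le_one (by positivity)
        _ ≤ 2 := by linarith
    · rw [not_le] at hx
      have ht := mul_burgersPhi (‖x‖ ^ 2 / 4)
      have hexp : 0 < Real.exp (-(‖x‖ ^ 2 / 4)) := Real.exp_pos _
      have h1 : ‖x‖ ≤ ‖x‖ ^ 2 / 2 := by nlinarith
      calc burgersPhi (‖x‖ ^ 2 / 4) * ‖x‖ ≤ burgersPhi (‖x‖ ^ 2 / 4) * (‖x‖ ^ 2 / 2) := by gcongr
        _ = 2 * (‖x‖ ^ 2 / 4 * burgersPhi (‖x‖ ^ 2 / 4)) := by ring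
        _ = 2 * (1 - Real.exp (-(‖x‖ ^ 2 / 4))) := by rw [ht]
        _ ≤ 2 := by nlinarith
  rw [hn]
  calc (8 * Real.pi)⁻¹ * (burgersPhi (‖x‖ ^ 2 / 4) * ‖x‖) ≤ (8 * Real.pi)⁻¹ * 2 := by gcongr
    _ = (4 * Real.pi)⁻¹ := by field_simp; norm_num

/-- `x ↦ ⟪v^G(x), ∇w(x)⟫` is continuous for `w ∈ C¹`. [folklore] -/
theorem continuous_inner_gaussVortexVelocity_gradient {w : EuclideanSpace ℝ (Fin 2) → ℝ}
    (hw : ContDiff ℝ 1 w) : Continuous fun x => ⟪gaussVortexVelocity x, gradient w x⟫_ℝ :=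
  continuous_gaussVortexVelocity.inner (continuous_gradient_of_contDiff hw)

/-! ### The cut-offs `χ_R = Fluid.cutoff R`: gradient and moment bounds -/

/-- Far from the origin the cut-off is locally zero, so its derivative vanishes (private copy of
`fderiv_cutoff_eq_zero_of_lt` of `GIPRemainderSliceEstimates`, whose import closure is avoided
here). [folklore] -/
private theorem fderiv_cutoff_eq_zero_of_two_mul_lt {R : ℝ} (hR : 0 < R)
    {x : EuclideanSpace ℝ (Fin 2)} (hx : 2 * R < ‖x‖) : fderiv ℝ (cutoff R) x = 0 := by
  have hev : (cutoff (E := EuclideanSpace ℝ (Fin 2)) R) =ᶠ[𝓝 x] fun _ => 0 := by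
    have hopen : IsOpen {y : EuclideanSpace ℝ (Fin 2) | 2 * R < ‖y‖} :=
      isOpen_lt continuous_const continuous_norm
    filter_upwards [hopen.mem_nhds hx] with y hy
    exact cutoff_eq_zero hR hy.le
  rw [hev.fderiv_eq, fderiv_fun_const, Pi.zero_apply]

/-- **Uniform bounds for the cut-offs at scales `R ≥ 1`**: `‖Dχ_R‖ ≤ C` and `‖Dχ_R(x)‖‖x‖ ≤ 2C`
(the derivative lives on `‖x‖ ≤ 2R` and is `≤ C/R` there). [folklore] -/
theorem exists_cutoff_fderiv_bounds :
    ∃ C : ℝ, 0 ≤ C ∧ ∀ R : ℝ, 1 ≤ R → ∀ x : EuclideanSpace ℝ (Fin 2),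
      ‖fderiv ℝ (cutoff R) x‖ ≤ C ∧ ‖fderiv ℝ (cutoff R) x‖ * ‖x‖ ≤ 2 * C := by
  obtain ⟨C, hC0, hC⟩ := exists_norm_fderiv_cutoff_le (E := EuclideanSpace ℝ (Fin 2))
  refine ⟨C, hC0, fun R hR x => ?_⟩
  have hR0 : 0 < R := by linarith
  refine ⟨?_, ?_⟩
  · calc ‖fderiv ℝ (cutoff R) x‖ ≤ C / R := hC R hR0 x
      _ ≤ C / 1 := by gcongr
      _ = C := div_one C
  · by_cases hx : ‖x‖ ≤ 2 * R
    · calc ‖fderiv ℝ (cutoff R) x‖ * ‖x‖ ≤ C / R * (2 * R) := by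
            gcongr; exact hC R hR0 x
        _ = 2 * C := by field_simp
    · rw [not_le] at hx
      rw [fderiv_cutoff_eq_zero_of_two_mul_lt hR0 hx, norm_zero, zero_mul]
      positivity

/-! ### Integrations by parts against a compactly supported weight -/

/-- One integration by parts: `∫ ρ w ∂ᵥ(∂ᵥw) = −∫ (ρ ∂ᵥw + w ∂ᵥρ) ∂ᵥw` for `w ∈ C²` and a `C¹`
compactly supported weight `ρ` (no boundary terms). [folklore] -/
theorem integral_mul_mul_fderiv_fderiv_apply_eq {w ρ : EuclideanSpace ℝ (Fin 2) → ℝ}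
    (hw : ContDiff ℝ 2 w) (hρ : ContDiff ℝ 1 ρ) (hρc : HasCompactSupport ρ)
    (v : EuclideanSpace ℝ (Fin 2)) :
    ∫ x, ρ x * (w x * fderiv ℝ (fun y => fderiv ℝ w y v) x v) =
      -∫ x, (ρ x * fderiv ℝ w x v + w x * fderiv ℝ ρ x v) * fderiv ℝ w x v := by
  have hassoc : ∀ x, ρ x * (w x * fderiv ℝ (fun y => fderiv ℝ w y v) x v) =
      ρ x * w x * fderiv ℝ (fun y => fderiv ℝ w y v) x v := fun x => by ring
  simp_rw [hassoc]
  have hw1 : ContDiff ℝ 1 w := hw.of_le one_le_two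
  have hg1 : ContDiff ℝ 1 fun y => fderiv ℝ w y v :=
    (hw.fderiv_right (m := 1) le_rfl).clm_apply contDiff_const
  have hf1 : ContDiff ℝ 1 fun y => ρ y * w y := hρ.mul hw1
  have hfc : HasCompactSupport fun y => ρ y * w y := hρc.mul_right
  have hwc : Continuous w := hw.continuous
  have hgc : Continuous fun y => fderiv ℝ w y v := hg1.continuous
  have hg'c : Continuous fun x => fderiv ℝ (fun y => fderiv ℝ w y v) x v :=
    (hg1.continuous_fderiv one_ne_zero).clm_apply continuous_const
  have hf'c : Continuous fun x => fderiv ℝ (fun y => ρ y * w y) x v :=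
    (hf1.continuous_fderiv one_ne_zero).clm_apply continuous_const
  have hderiv : ∀ x, fderiv ℝ (fun y => ρ y * w y) x v =
      ρ x * fderiv ℝ w x v + w x * fderiv ℝ ρ x v := by
    intro x
    rw [fderiv_fun_mul (hρ.differentiable one_ne_zero x) (hw1.differentiable one_ne_zero x)]
    simp only [add_apply, FunLike.coe_smul, Pi.smul_apply, smul_eq_mul]
  rw [integral_mul_fderiv_eq_neg_fderiv_mul_of_integrable]
  · congr 1
    exact integral_congr_ae (Eventually.of_forall fun x => by simp only [hderiv])
  · exact (hf'c.mul hgc).integrable_of_hasCompactSupport (hfc.fderiv_apply (𝕜 := ℝ) v).mul_right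
  · exact ((hρ.continuous.mul hwc).mul hg'c).integrable_of_hasCompactSupport hfc.mul_right
  · exact ((hρ.continuous.mul hwc).mul hgc).integrable_of_hasCompactSupport hfc.mul_right
  · exact fun x _ => hf1.differentiable one_ne_zero x
  · exact fun x _ => hg1.differentiable one_ne_zero x

/-- **The Laplacian pairing against a compactly supported weight** (Green once, in coordinates):
for `w ∈ C²(ℝ²)` and a `C¹` compactly supported `ρ`,
`∫ ρ w Δw = −∫ (ρ ((∂₀w)² + (∂₁w)²) + w (∂₀ρ ∂₀w + ∂₁ρ ∂₁w))`. [folklore] -/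
theorem integral_mul_mul_laplacian_eq {w ρ : EuclideanSpace ℝ (Fin 2) → ℝ} (hw : ContDiff ℝ 2 w)
    (hρ : ContDiff ℝ 1 ρ) (hρc : HasCompactSupport ρ) :
    ∫ x, ρ x * (w x * Δ w x) =
      -∫ x, (ρ x * (fderiv ℝ w x (EuclideanSpace.single 0 1) ^ 2 +
          fderiv ℝ w x (EuclideanSpace.single 1 1) ^ 2) +
        w x * (fderiv ℝ ρ x (EuclideanSpace.single 0 1) * fderiv ℝ w x (EuclideanSpace.single 0 1) +
          fderiv ℝ ρ x (EuclideanSpace.single 1 1) * fderiv ℝ w x (EuclideanSpace.single 1 1))) :=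
    by
  have hw1 : ContDiff ℝ 1 w := hw.of_le one_le_two
  have hwc : Continuous w := hw.continuous
  have hlap : ∀ x, Δ w x =
      fderiv ℝ (fun y => fderiv ℝ w y (EuclideanSpace.single 0 1)) x (EuclideanSpace.single 0 1) +
      fderiv ℝ (fun y => fderiv ℝ w y (EuclideanSpace.single 1 1)) x (EuclideanSpace.single 1 1) :=
    fun x => by
    rw [laplacian_eq_sum_fderiv_fderiv (EuclideanSpace.basisFun (Fin 2) ℝ) hw x, Fin.sum_univ_two,
      EuclideanSpace.basisFun_apply, EuclideanSpace.basisFun_apply]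
  -- integrability of the coordinate pieces
  have hgc : ∀ v : EuclideanSpace ℝ (Fin 2), Continuous fun y => fderiv ℝ w y v := fun v =>
    ((hw.fderiv_right (m := 1) le_rfl).clm_apply contDiff_const).continuous
  have hg'c : ∀ v : EuclideanSpace ℝ (Fin 2),
      Continuous fun x => fderiv ℝ (fun y => fderiv ℝ w y v) x v := fun v =>
    (((hw.fderiv_right (m := 1) le_rfl).clm_apply contDiff_const).continuous_fderiv
      one_ne_zero).clm_apply continuous_const
  have hρ'c : ∀ v : EuclideanSpace ℝ (Fin 2), Continuous fun x => fderiv ℝ ρ x v := fun v =>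
    (hρ.continuous_fderiv one_ne_zero).clm_apply continuous_const
  have hfc : HasCompactSupport fun y => ρ y * w y := hρc.mul_right
  have hA : ∀ v : EuclideanSpace ℝ (Fin 2),
      Integrable fun x => ρ x * (w x * fderiv ℝ (fun y => fderiv ℝ w y v) x v) := fun v =>
    (hρ.continuous.mul (hwc.mul (hg'c v))).integrable_of_hasCompactSupport hρc.mul_right
  have hB : ∀ v : EuclideanSpace ℝ (Fin 2), Integrable fun x =>
      (ρ x * fderiv ℝ w x v + w x * fderiv ℝ ρ x v) * fderiv ℝ w x v := by
    intro v
    refine (((hρ.continuous.mul (hgc v)).add (hwc.mul (hρ'c v))).mul (hgc v))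
      |>.integrable_of_hasCompactSupport ?_
    refine hρc.mono' fun x hx => ?_
    by_contra hxρ
    apply hx
    simp [image_eq_zero_of_notMem_tsupport hxρ, fderiv_of_notMem_tsupport ℝ hxρ]
  simp_rw [hlap, mul_add]
  rw [integral_add (hA (EuclideanSpace.single 0 1)) (hA (EuclideanSpace.single 1 1)),
    integral_mul_mul_fderiv_fderiv_apply_eq hw hρ hρc (EuclideanSpace.single 0 1),
    integral_mul_mul_fderiv_fderiv_apply_eq hw hρ hρc (EuclideanSpace.single 1 1), ← neg_add,
    ← integral_add (hB (EuclideanSpace.single 0 1)) (hB (EuclideanSpace.single 1 1))]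
  congr 1
  refine integral_congr_ae (Eventually.of_forall fun x => ?_)
  ring

/-- **The drift pairing**: `∫ c w ∂ᵥw = −½ ∫ (∂ᵥc) w²` for `w ∈ C¹` and a `C¹` compactly supported
coefficient `c` (`∂ᵥ(w²) = 2w∂ᵥw`, one integration by parts). [folklore] -/
theorem integral_mul_mul_fderiv_apply_eq {w c : EuclideanSpace ℝ (Fin 2) → ℝ} (hw : ContDiff ℝ 1 w)
    (hc : ContDiff ℝ 1 c) (hcc : HasCompactSupport c) (v : EuclideanSpace ℝ (Fin 2)) :
    ∫ x, c x * (w x * fderiv ℝ w x v) = -(1 / 2) * ∫ x, fderiv ℝ c x v * w x ^ 2 := by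
  have hwc : Continuous w := hw.continuous
  have hwd : ∀ x, DifferentiableAt ℝ w x := fun x => hw.differentiable one_ne_zero x
  have hsq1 : ContDiff ℝ 1 fun y => w y ^ 2 := hw.pow 2
  have hderiv : ∀ x, fderiv ℝ (fun y => w y ^ 2) x v = 2 * (w x * fderiv ℝ w x v) := by
    intro x
    rw [((hwd x).hasFDerivAt.pow 2).fderiv]
    simp
    ring
  have hgc : Continuous fun y => fderiv ℝ w y v :=
    (hw.continuous_fderiv one_ne_zero).clm_apply continuous_const
  have hc'c : Continuous fun x => fderiv ℝ c x v :=
    (hc.continuous_fderiv one_ne_zero).clm_apply continuous_const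
  have key : ∫ x, c x * fderiv ℝ (fun y => w y ^ 2) x v = -∫ x, fderiv ℝ c x v * w x ^ 2 := by
    rw [integral_mul_fderiv_eq_neg_fderiv_mul_of_integrable]
    · exact (hc'c.mul (hwc.pow 2)).integrable_of_hasCompactSupport
        (hcc.fderiv_apply (𝕜 := ℝ) v).mul_right
    · simp_rw [hderiv]
      exact (hc.continuous.mul (continuous_const.mul (hwc.mul hgc))).integrable_of_hasCompactSupport
        hcc.mul_right
    · exact (hc.continuous.mul (hwc.pow 2)).integrable_of_hasCompactSupport hcc.mul_right
    · exact fun x _ => hc.differentiable one_ne_zero x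
    · exact fun x _ => hsq1.differentiable one_ne_zero x
  simp_rw [hderiv] at key
  have h2 : ∫ x, c x * (2 * (w x * fderiv ℝ w x v)) = 2 * ∫ x, c x * (w x * fderiv ℝ w x v) := by
    rw [← integral_const_mul]
    exact integral_congr_ae (Eventually.of_forall fun x => by ring)
  rw [h2] at key
  linarith

/-! ### Fatou along a truncation sequence -/

/-- **Fatou along truncations.** A continuous nonnegative `F` whose truncated integrals `∫ χ_k² F`
are bounded uniformly in `k`, for continuous compactly supported `χ_k → 1` pointwise, is
integrable (`∫⁻ F ≤ liminf ∫⁻ χ_k² F`). [folklore] -/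
theorem integrable_of_integral_sq_mul_le {F : EuclideanSpace ℝ (Fin 2) → ℝ}
    {χ : ℕ → EuclideanSpace ℝ (Fin 2) → ℝ} (hF : Continuous F) (hF0 : ∀ x, 0 ≤ F x)
    (hχ : ∀ k, Continuous (χ k)) (hχc : ∀ k, HasCompactSupport (χ k))
    (hχ1 : ∀ x, Tendsto (fun k => χ k x) atTop (𝓝 1)) {M : ℝ}
    (hM : ∀ k, ∫ x, χ k x ^ 2 * F x ≤ M) : Integrable F := by
  refine ⟨hF.aestronglyMeasurable, ?_⟩
  rw [hasFiniteIntegral_iff_ofReal (Eventually.of_forall hF0)]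
  have hint : ∀ k, Integrable fun x : EuclideanSpace ℝ (Fin 2) => χ k x ^ 2 * F x := by
    intro k
    refine (((hχ k).pow 2).mul hF).integrable_of_hasCompactSupport ((hχc k).mono ?_)
    intro x hx
    contrapose! hx
    simp only [Function.mem_support, ne_eq, not_not] at hx ⊢
    simp [hx]
  have hnn : ∀ k (x : EuclideanSpace ℝ (Fin 2)), 0 ≤ χ k x ^ 2 * F x := fun k x =>
    mul_nonneg (sq_nonneg _) (hF0 x)
  have hlim : ∀ x : EuclideanSpace ℝ (Fin 2),
      Tendsto (fun k => ENNReal.ofReal (χ k x ^ 2 * F x)) atTop (𝓝 (ENNReal.ofReal (F x))) := by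
    intro x
    have h := ((hχ1 x).pow 2).mul_const (F x)
    rw [one_pow, one_mul] at h
    exact ENNReal.tendsto_ofReal h
  calc ∫⁻ x, ENNReal.ofReal (F x)
      = ∫⁻ x, liminf (fun k => ENNReal.ofReal (χ k x ^ 2 * F x)) atTop :=
        lintegral_congr fun x => ((hlim x).liminf_eq).symm
    _ ≤ liminf (fun k => ∫⁻ x, ENNReal.ofReal (χ k x ^ 2 * F x)) atTop :=
        lintegral_liminf_le' fun k => (hint k).aemeasurable.ennreal_ofReal
    _ = liminf (fun k => ENNReal.ofReal (∫ x, χ k x ^ 2 * F x)) atTop := by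
        refine congr_arg₂ _ (funext fun k => ?_) rfl
        rw [ofReal_integral_eq_lintegral_ofReal (hint k) (Eventually.of_forall (hnn k))]
    _ ≤ ENNReal.ofReal M :=
        liminf_le_of_frequently_le'
          ((Eventually.of_forall fun k => ENNReal.ofReal_le_ofReal (hM k)).frequently)
    _ < ⊤ := ENNReal.ofReal_lt_top

/-! ### Small coordinate facts on `ℝ²` -/

/-- `‖∇f‖² = (∂₀f)² + (∂₁f)²` on `ℝ²`. [folklore] -/
theorem norm_gradient_sq_eq_fin_two (f : EuclideanSpace ℝ (Fin 2) → ℝ)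
    (x : EuclideanSpace ℝ (Fin 2)) :
    ‖gradient f x‖ ^ 2 =
      fderiv ℝ f x (EuclideanSpace.single 0 1) ^ 2 + fderiv ℝ f x (EuclideanSpace.single 1 1) ^ 2 :=
    by
  rw [← real_inner_self_eq_norm_sq, inner_gradient_gradient_fin_two]
  ring

/-- `|∂ᵢf| ≤ ‖∇f‖` on `ℝ²`. [folklore] -/
theorem abs_fderiv_apply_single_le_norm_gradient (f : EuclideanSpace ℝ (Fin 2) → ℝ)
    (x : EuclideanSpace ℝ (Fin 2)) (i : Fin 2) :
    |fderiv ℝ f x (EuclideanSpace.single i (1 : ℝ))| ≤ ‖gradient f x‖ := by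
  rw [norm_gradient_eq_norm_fderiv_fin_two, ← Real.norm_eq_abs]
  calc ‖fderiv ℝ f x (EuclideanSpace.single i (1 : ℝ))‖
      ≤ ‖fderiv ℝ f x‖ * ‖EuclideanSpace.single i (1 : ℝ)‖ := ContinuousLinearMap.le_opNorm _ _
    _ = ‖fderiv ℝ f x‖ := by simp

/-! ### Scalar inequalities for the truncated energy estimate -/

/-- `|ρ T w| ≤ g(T² + w²)/2` for `0 ≤ ρ ≤ g`. [folklore] -/
theorem abs_weight_mul_mul_le {ρ g T w : ℝ} (hρ0 : 0 ≤ ρ) (hρg : ρ ≤ g) :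
    |ρ * (T * w)| ≤ (g * T ^ 2 + g * w ^ 2) / 2 := by
  rw [abs_mul, abs_of_nonneg hρ0, abs_mul]
  have h3 : 2 * (|T| * |w|) ≤ T ^ 2 + w ^ 2 := by
    have h := sq_nonneg (|T| - |w|)
    rw [sub_sq, sq_abs, sq_abs] at h
    linarith
  have hg : 0 ≤ g := hρ0.trans hρg
  calc ρ * (|T| * |w|) ≤ g * (|T| * |w|) := mul_le_mul_of_nonneg_right hρg (by positivity)
    _ ≤ g * ((T ^ 2 + w ^ 2) / 2) := mul_le_mul_of_nonneg_left (by linarith) hg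
    _ = (g * T ^ 2 + g * w ^ 2) / 2 := by ring

/-- The cut-off commutator term: `−2χ g w s ≤ χ²g n²/4 + 16C² g w²` when `|s| ≤ 2Cn`
(`s = ⟪∇χ, ∇w⟫`, `n = ‖∇w‖`). [folklore] -/
theorem neg_cutoff_commutator_le {C χ g w n s : ℝ} (hχ0 : 0 ≤ χ) (hg : 0 ≤ g)
    (hs : |s| ≤ 2 * C * n) :
    -(χ * (2 * g * w * s)) ≤ χ ^ 2 * g * n ^ 2 / 4 + 16 * C ^ 2 * (g * w ^ 2) := by
  have hws : -(w * s) ≤ |w| * (2 * C * n) :=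
    (neg_le_abs _).trans (by rw [abs_mul]; exact mul_le_mul_of_nonneg_left hs (abs_nonneg _))
  have am : 4 * C * χ * |w| * n ≤ χ ^ 2 * n ^ 2 / 4 + 16 * C ^ 2 * w ^ 2 := by
    have h := sq_nonneg (χ * n / 2 - 4 * C * |w|)
    have e : (χ * n / 2 - 4 * C * |w|) ^ 2 =
        χ ^ 2 * n ^ 2 / 4 - 4 * C * χ * |w| * n + 16 * C ^ 2 * w ^ 2 := by
      rw [← sq_abs w]; ring
    linarith
  calc -(χ * (2 * g * w * s)) = 2 * χ * g * (-(w * s)) := by ring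
    _ ≤ 2 * χ * g * (|w| * (2 * C * n)) := mul_le_mul_of_nonneg_left hws (by positivity)
    _ = g * (4 * C * χ * |w| * n) := by ring
    _ ≤ g * (χ ^ 2 * n ^ 2 / 4 + 16 * C ^ 2 * w ^ 2) := mul_le_mul_of_nonneg_left am hg
    _ = χ ^ 2 * g * n ^ 2 / 4 + 16 * C ^ 2 * (g * w ^ 2) := by ring

/-- The local rotation term: `−ρ R V w ≤ ρ n²/4 + (R C_v)² g w²` when `|V| ≤ C_v n`, `0 ≤ ρ ≤ g`.
[folklore] -/
theorem neg_weight_mul_rotation_le {ρ g R V w n Cv : ℝ} (hρ0 : 0 ≤ ρ) (hρg : ρ ≤ g)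
    (hV : |V| ≤ Cv * n) :
    -(ρ * (R * V * w)) ≤ ρ * n ^ 2 / 4 + (R * Cv) ^ 2 * (g * w ^ 2) := by
  have h1 : -(R * V * w) ≤ |R| * (Cv * n) * |w| := by
    refine (neg_le_abs _).trans ?_
    rw [abs_mul, abs_mul]
    gcongr
  have am : |R| * (Cv * n) * |w| ≤ n ^ 2 / 4 + (R * Cv) ^ 2 * w ^ 2 := by
    have h := sq_nonneg (n / 2 - |R| * Cv * |w|)
    have e : (n / 2 - |R| * Cv * |w|) ^ 2 =
        n ^ 2 / 4 - |R| * (Cv * n) * |w| + (R * Cv) ^ 2 * w ^ 2 := by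
      rw [← sq_abs w, mul_pow, ← sq_abs R]; ring
    linarith
  calc -(ρ * (R * V * w)) = ρ * (-(R * V * w)) := by ring
    _ ≤ ρ * (n ^ 2 / 4 + (R * Cv) ^ 2 * w ^ 2) := mul_le_mul_of_nonneg_left (h1.trans am) hρ0
    _ = ρ * n ^ 2 / 4 + ρ * ((R * Cv) ^ 2 * w ^ 2) := by ring
    _ ≤ ρ * n ^ 2 / 4 + g * ((R * Cv) ^ 2 * w ^ 2) := by gcongr
    _ = ρ * n ^ 2 / 4 + (R * Cv) ^ 2 * (g * w ^ 2) := by ring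

/-- The sign of the combined drift coefficient `∂₀(λ x₀ χ² g)`: it is `≥ −4C g` when
`|x₀||∂₀χ| ≤ 2C`, `0 ≤ λ ≤ 1`, `0 ≤ χ ≤ 1`. [folklore] -/
theorem neg_le_drift_coeff {lam χ g x0 d0 C : ℝ} (hl0 : 0 ≤ lam) (hl1 : lam ≤ 1) (hχ0 : 0 ≤ χ)
    (hχ1 : χ ≤ 1) (hg : 0 ≤ g) (hprod : |x0| * |d0| ≤ 2 * C) :
    -(4 * C * g) ≤ lam * χ ^ 2 * g + 2 * lam * χ * g * (x0 * d0) +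
      lam * (1 - lam) / 2 * x0 ^ 2 * χ ^ 2 * g := by
  have hneg : -(|x0| * |d0|) ≤ x0 * d0 := by rw [← abs_mul]; exact neg_abs_le _
  have hlc : lam * χ ≤ 1 := mul_le_one₀ hl1 hχ0 hχ1
  have hC : 0 ≤ 2 * C := (mul_nonneg (abs_nonneg x0) (abs_nonneg d0)).trans hprod
  have hcoef : 0 ≤ 2 * lam * χ * g := by positivity
  have hmid : -(4 * C * g) ≤ 2 * lam * χ * g * (x0 * d0) := by
    calc -(4 * C * g) = 2 * g * (-(2 * C)) := by ring
      _ ≤ 2 * (lam * χ) * g * (-(2 * C)) := by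
          apply mul_le_mul_of_nonpos_right _ (by linarith)
          nlinarith
      _ = 2 * lam * χ * g * (-(2 * C)) := by ring
      _ ≤ 2 * lam * χ * g * (-(|x0| * |d0|)) := mul_le_mul_of_nonneg_left (by linarith) hcoef
      _ ≤ 2 * lam * χ * g * (x0 * d0) := mul_le_mul_of_nonneg_left hneg hcoef
  have hpos1 : 0 ≤ lam * χ ^ 2 * g := by positivity
  have hpos3 : 0 ≤ lam * (1 - lam) / 2 * x0 ^ 2 * χ ^ 2 * g := by
    have : 0 ≤ 1 - lam := by linarith
    positivity
  linarith

/-- Registered tools stub of crux stmt-NavierStokesRegularity-17973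
(`stub_gradientInClassIBPTools`): `v^G` is bounded, the Laplacian and drift pairings against a
compactly supported weight, and Fatou along truncations. [folklore] -/
theorem stub_gradientInClassIBPTools :
    (∀ x : EuclideanSpace ℝ (Fin 2), ‖gaussVortexVelocity x‖ ≤ (4 * Real.pi)⁻¹) ∧
    (∀ (w ρ : EuclideanSpace ℝ (Fin 2) → ℝ), ContDiff ℝ 2 w → ContDiff ℝ 1 ρ →
      HasCompactSupport ρ →
      ∫ x, ρ x * (w x * Δ w x) =
        -∫ x, (ρ x * (fderiv ℝ w x (EuclideanSpace.single 0 1) ^ 2 +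
            fderiv ℝ w x (EuclideanSpace.single 1 1) ^ 2) +
          w x * (fderiv ℝ ρ x (EuclideanSpace.single 0 1) *
              fderiv ℝ w x (EuclideanSpace.single 0 1) +
            fderiv ℝ ρ x (EuclideanSpace.single 1 1) *
              fderiv ℝ w x (EuclideanSpace.single 1 1)))) ∧
    (∀ (w c : EuclideanSpace ℝ (Fin 2) → ℝ) (v : EuclideanSpace ℝ (Fin 2)), ContDiff ℝ 1 w →
      ContDiff ℝ 1 c → HasCompactSupport c →
      ∫ x, c x * (w x * fderiv ℝ w x v) = -(1 / 2) * ∫ x, fderiv ℝ c x v * w x ^ 2) ∧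
    (∀ (F : EuclideanSpace ℝ (Fin 2) → ℝ) (χ : ℕ → EuclideanSpace ℝ (Fin 2) → ℝ), Continuous F →
      (∀ x, 0 ≤ F x) → (∀ k, Continuous (χ k)) → (∀ k, HasCompactSupport (χ k)) →
      (∀ x, Tendsto (fun k => χ k x) atTop (𝓝 1)) → ∀ M : ℝ,
      (∀ k, ∫ x, χ k x ^ 2 * F x ≤ M) → Integrable F) :=
  ⟨norm_gaussVortexVelocity_le_inv_four_pi,
    fun _ _ hw hρ hρc => integral_mul_mul_laplacian_eq hw hρ hρc,
    fun _ _ v hw hc hcc => integral_mul_mul_fderiv_apply_eq hw hc hcc v,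
    fun _ _ hF hF0 hχ hχc hχ1 _ hM => integrable_of_integral_sq_mul_le hF hF0 hχ hχc hχ1 hM⟩

end Summit.NavierStokesRegularity.NavierStokesRegularity.Theorems
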